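import Literature.AlgebraicGeometry.HodgeTheory.WeilClassesFieldDecomposableOfSymmetric
import Literature.AlgebraicGeometry.HodgeTheory.WeilClassesFieldIntersections
import Literature.AlgebraicGeometry.HodgeTheory.AbelianLowDimensionWeilReductionProofs
import Literature.AlgebraicGeometry.HodgeTheory.LefschetzOneOneHolds
import HarnessLib

/-!
# Weil classes relative to `F = ℚ(φ)` with `φ` Rosati-SKEW and a Rosati-symmetric unit `ψ` anticommuting with `φ`
# are decomposable — hence ALGEBRAIC: `G_div(X) ⊆ Sl_F(V_X)` by the determinant of a symplectic isometry
# (Moonen–Zarhin 1998, Criterion (2): the type-2 mechanism, PROVED on the carrier, × Lefschetz `(1,1)`)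

Layer `Literature/AlgebraicGeometry/HodgeTheory`; THEOREMS ONLY — no definition, no named fact, sorry-free (D-0026,
net debt 0). Sibling of the seat's `HodgeTheory/WeilClassesFieldDecomposableOfSymmetric` (g17-#3: `F = ℚ(φ)` with
`φ^*` `Q_h`-SYMMETRIC ⟹ `W_F` decomposable, via «an isometry of a non-degenerate alternating form has determinant `1`»).
Here `φ^*` is `Q_h`-SKEW (`φ† = -φ`) and there is an endomorphism `ψ` with `ψ^*` `Q_h`-symmetric, invertible on `H¹`, and
`ψ^* φ^* = -φ^* ψ^*` — the configuration «`F = E(α)`, `α† = -α`, `β† = β`, `αβ = -βα`» of a quadratic subfield of an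
indefinite quaternion algebra `D = End⁰(Y)` (Moonen–Zarhin's «`Y` of Type 2», where ALL `W_F` are decomposable). The
eigenspaces `V^{(τ)}` of the skew `φ^*` are `Q_h`-ISOTROPIC, so the symmetric road does not apply; instead
`B(x, y) = Q_h(x, ψ^* y)` is a non-degenerate alternating form on `V^{(τ)}` preserved by `G_div(X)(ℂ)`.

## The print

B. J. J. Moonen, Yu. G. Zarhin, *Weil classes on abelian varieties*, J. reine angew. Math. **496** (1998) =
arXiv:alg-geom/9612017 [MoonenZarhin1998WeilClasses] (held text `paper:arxiv-alg-geom_9612017`), Introduction (chunk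
p0001 L10–L18) «As a consequence of the Lefschetz theorem on `(1,1)` classes, the decomposable classes are
algebraic»; §1 Criterion (2) (chunk p0003 L46–L58) and its proof (chunk p0003 L62–L70, verbatim): «First assume that `X` is either of type 1, 2 or
of type 3 with `m = 1`, or that `X` is of type 4 with `d = 1` and `m = 1`. We claim that, in these cases, `G_div(X)`
acts as the identity on `W_F` if and only if `F ⊆ B`. … Conversely, suppose that `F ⊆ B`, so that
`G_div(X) ⊆ Gl_F(V_X)`. In the cases we are considering, the group `G_div(X)` is connected and semi-simple, so
`G_div(X) ⊆ Sl_F(V_X)`, hence `G_div(X)` acts trivially on `W_F`.»; chunk p0002 L86–L92 «`SP(V, φ) ⊗ ℂ = ∏_τ SP(V^{(τ)}, φ^{(τ)})`».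
D. McDuff, D. Salamon, *Introduction to Symplectic Topology* (OUP 2017) [McDuffSalamon2017], Lemma 1.1.15 (held chunk
p0026 L22): «Every symplectic matrix has determinant 1.»

## What is proved (carriers as in g14-#3 / g17-#3; hypotheses: `P(φ) = 0`, `P ∈ ℤ[T]` monic irreducible of degree
`e`, `e · 2m = 2 dim A`, `h ∈ B¹(A) ⊗ ℂ`, `Q_h` non-degenerate, `0 < dim A`, `Q_h(φ^* x, y) = -Q_h(x, φ^* y)`,
`Q_h(ψ^* x, y) = Q_h(x, ψ^* y)`, `ψ^*` a unit of `End(H¹(A(ℂ); ℂ))`, `ψ^* φ^* = -φ^* ψ^*`)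

* §1 **`pullbackOne_mem_adjoin_symmetricPullbackSpan_of_skew`** — `φ^* ∈ B ⊗ ℂ = Algebra.adjoin ℂ (S_λ ⊗ ℂ)`:
  `ψ^* φ^* = (ψ ≫ φ)^* = (φ ∘ ψ)^*` is `Q_h`-symmetric, `(ψ^*)⁻¹ ∈ B ⊗ ℂ` by inverse-closedness of the
  finite-dimensional algebra, `φ^* = (ψ^*)⁻¹ (ψ^* φ^*)` — the carrier form of «`F ⊆ B`».
* §2 **`detOnEigenspace_eq_one_of_mem_divisorLefschetzGroup_of_skew`** — every `u ∈ G_div(X)(ℂ)` has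
  `det(u | V^{(τ)}) = 1` on every eigenspace `V^{(τ)} = ker(φ^* - τ)`: `Q_h(V^{(τ)}, V^{(τ′)}) = 0` unless `τ′ = -τ`
  (skew-orthogonality), `ψ^*` exchanges `V^{(τ)}` and `V^{(-τ)}`, so `B(x, y) = ℓ(Q_h(x, ψ^* y))` is a non-degenerate
  ALTERNATING form on `V^{(τ)}` preserved by `u` (which commutes with `φ^* ∈ B ⊗ ℂ` and with `ψ^* ∈ S_λ ⊗ ℂ`); then
  `LinearAlgebra.det_eq_one_of_isAlt_of_forall_apply_apply_eq` (g17-#3); the same for Milne's `S(A)(h)(ℂ) ≤ G_div`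
  (`…_of_mem_unitaryCentralizerGroup_of_skew`).
* §3 **`weilClassesField_le_divisorClassesSpan_of_skew`** — `W_F ⊗ ℂ ≤ 𝒟ᵐ ⊗ ℂ`: THE WEIL CLASSES RELATIVE TO
  `F = ℚ(φ)` ARE DECOMPOSABLE (g14-#3's `…_iff_forall_detOnEigenspace_eq_one_of_mem_adjoin` fed with §1–§2); hence
  `weilClassesField_le_hodgeClassSpan_of_skew` (`≤ ℬᵐ ⊗ ℂ`) and **`weilClassesField_le_algebraicClasses_of_skew`**
  (`≤ N^m H^{2m}`, `algebraicClasses`): «as a consequence of the Lefschetz theorem on `(1,1)` classes, the decomposable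
  classes are algebraic» — by the tree's THEOREM `lefschetzOneOne_rational_holds` (Voisin I Thm. 11.30) through
  `AbelianVariety.divisorClassesSpan_le_algebraicClasses`; element form `mem_algebraicClasses_of_mem_weilClassesField_of_skew`.

Scope (said once): the hypotheses are carrier statements and the theorems hold for EVERY complex abelian variety; the
configuration is the print's type 2 one (and its absence in type 3, `m = 1` — `†` the canonical involution, `S_λ = E`
— and in type 4, `d = m = 1` — `End⁰` commutative — is consistent with the exceptional alternatives printed there).
NOT here: subfields `F ⊆ D` generated by an element that is neither `†`-symmetric nor `†`-skew; type 4 with `F ⊆ E`,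
`F ⊄ E₀` (the `θ`-condition); the exceptional alternatives; Tate classes.

## References

* [MoonenZarhin1998WeilClasses] B. J. J. Moonen, Yu. G. Zarhin, J. reine angew. Math. 496 (1998) =
  arXiv:alg-geom/9612017, §1 Criterion (2) and its proof (chunk p0003 L46–L70); chunk p0002 L54–L58 (`S_λ`, `B`),
  L86–L92 (`SP ⊗ ℂ = ∏_τ`).
* [McDuffSalamon2017] D. McDuff, D. Salamon, Introduction to Symplectic Topology, 3rd ed. (OUP 2017), Lemma 1.1.15,
  Thm. 2.1.3.
* [BourbakiAlgebreVIII2012] N. Bourbaki, Algèbre, Chapitre VIII (Springer 2012), §1 n°2 (inverse-closed subalgebras).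
* [Milne1999LefschetzClasses] J. S. Milne, Lefschetz classes on abelian varieties, Duke Math. J. 96 (1999), §1 p. 644
  (`S(A)`).
* [LangeBirkenhake1992] H. Lange, Ch. Birkenhake, Complex Abelian Varieties (1992), §5.1 (Rosati = adjoint), §5.5
  (endomorphism algebras of simple abelian varieties, types I–IV).
* [HatcherAT2002] A. Hatcher, Algebraic Topology (CUP 2002), Thm. 3.11, §3.3 Cor. 3.37.
* [VoisinHodgeI2002] C. Voisin, Hodge Theory and Complex Algebraic Geometry I (CUP 2002), Thm. 11.30 (Lefschetz
  theorem on `(1,1)`-classes).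
* [vanGeemen1994HodgeAV] B. van Geemen, An introduction to the Hodge conjecture for abelian varieties, LNM 1594
  (1994), §2.4–2.5 (`𝒟ᵖ ⊆ ℬᵖ`, exceptional classes).

## Provenance

Lane `lit-hodgefound` (Track 2, Layer A), prover seat `lit-hodgefound-p21` (generation 17), row g17-#5: the type-2
companion of g17-#3.
-/

noncomputable section

open CategoryTheory Polynomial Module

namespace Literature.AlgebraicGeometry.HodgeTheory

open Literature.AlgebraicGeometry.Motives
open Literature.AlgebraicGeometry.VanGeemen1994 (hodgeClassSpan pullbackOne detOnEigenspace)
open Literature.AlgebraicGeometry.Milne1999 (unitaryCentralizerGroup)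
open Literature.AlgebraicTopology.SingularHomology
open Literature.Barriers.HodgeConjecture (divisorClassesSpan)

section HodgeTheory

variable {A : AbelianVariety ℂ} {h : complexBetti A.X 2} {φ ψ : A ⟶ A} {P : Polynomial ℤ} {e m : ℕ}
  {u : complexBetti A.X 1 ≃ₗ[ℂ] complexBetti A.X 1}

/-! ### §0 Small tools -/

/-- `(f ≫ g)^* = f^* ∘ g^*` on `H¹`, in `Module.End` (contravariance; the tree's private `pullbackOne_comp` of
`Milne1999/LefschetzCentraliserCM`, restated). [folklore] -/
private theorem pullbackOne_comp' (φ ψ : A ⟶ A) : pullbackOne A (φ ≫ ψ) = pullbackOne A φ * pullbackOne A ψ := by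
  change (complexBetti.map (φ.hom.hom.hom ≫ ψ.hom.hom.hom) 1).hom = _
  rw [complexBetti.map_comp, ModuleCat.hom_comp]
  rfl

/-- Inverse-closedness of finite-dimensional subalgebras (the tree's `DivisorLefschetzGroup.val_inv_mem_of_mem` of
`DivisorLefschetzGroupCommutant`, restated to keep the import closure small). [cite: BourbakiAlgebreVIII2012, §1 n°2] -/
private theorem val_inv_mem_of_mem' {K R : Type*} [Field K] [Ring R] [Algebra K R] (S : Subalgebra K R)
    [FiniteDimensional K S] (v : Rˣ) (hv : (v : R) ∈ S) : (↑v⁻¹ : R) ∈ S := by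
  let f : S →ₗ[K] S :=
    { toFun := fun b ↦ ⟨(v : R) * b, S.mul_mem hv b.2⟩
      map_add' := fun b c ↦ Subtype.ext (mul_add _ _ _)
      map_smul' := fun r b ↦ Subtype.ext (by simp [Algebra.mul_smul_comm]) }
  have hinj : Function.Injective f := by
    intro b c hbc
    have e : (v : R) * b = (v : R) * c := congrArg Subtype.val hbc
    exact Subtype.ext (by simpa using congrArg (fun r ↦ (↑v⁻¹ : R) * r) e)
  obtain ⟨b, hb⟩ := (LinearMap.injective_iff_surjective.1 hinj) ⟨1, S.one_mem⟩
  have e : (v : R) * b = 1 := congrArg Subtype.val hb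
  have : (↑v⁻¹ : R) = b := by
    calc (↑v⁻¹ : R) = ↑v⁻¹ * ((v : R) * b) := by rw [e, mul_one]
      _ = b := by rw [← mul_assoc, Units.inv_mul, one_mul]
  rw [this]
  exact b.2

/-! ### §1 `φ^* ∈ B ⊗ ℂ`: a skew element with a symmetric anticommuting unit lies in the algebra generated by `S_λ` -/

/-- **`φ^* = (ψ^*)⁻¹ (ψ^* φ^*) ∈ B ⊗ ℂ`**: if `φ^*` is `Q_h`-SKEW, `ψ^*` is `Q_h`-symmetric and invertible, and
`ψ^* φ^* = -φ^* ψ^*`, then `ψ^* φ^* = (φ ∘ ψ)^*` is `Q_h`-symmetric (so lies in `S_λ ⊗ ℂ`), `(ψ^*)⁻¹ ∈ B ⊗ ℂ` (inverse-closedness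
of the finite-dimensional algebra `B ⊗ ℂ ∋ ψ^*`), hence `φ^* ∈ B ⊗ ℂ` — the carrier form of «`F ⊆ B`» for a quadratic
`F = E(α)` generated by a `†`-skew `α` inside a quaternion algebra with a `†`-symmetric `β`, `αβ = -βα` (type 2).
[cite: MoonenZarhin1998WeilClasses, §1 (definition of S_λ and B, chunk p0002 L54–L58; proof of Criterion (2), chunk p0003 L62–L70)] -/
theorem pullbackOne_mem_adjoin_symmetricPullbackSpan_of_skew
    (hskew : ∀ x y : complexBetti A.X 1, polarizationPairingOne A.X h (A.dim - 1) (pullbackOne A φ x) y =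
      -polarizationPairingOne A.X h (A.dim - 1) x (pullbackOne A φ y))
    (hψsym : ∀ x y : complexBetti A.X 1, polarizationPairingOne A.X h (A.dim - 1) (pullbackOne A ψ x) y =
      polarizationPairingOne A.X h (A.dim - 1) x (pullbackOne A ψ y))
    (hψu : IsUnit (pullbackOne A ψ))
    (hanti : pullbackOne A ψ * pullbackOne A φ = -(pullbackOne A φ * pullbackOne A ψ)) :
    pullbackOne A φ ∈ Algebra.adjoin ℂ (symmetricPullbackSpan A h : Set (Module.End ℂ (complexBetti A.X 1))) := by
  set S := Algebra.adjoin ℂ (symmetricPullbackSpan A h : Set (Module.End ℂ (complexBetti A.X 1))) with hSdef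
  haveI : Module.Finite ℂ (complexBetti A.X 1) := abelianVarietyCohomologyExteriorH1_holds.finite_one A
  haveI : FiniteDimensional ℂ S := FiniteDimensional.of_injective S.val.toLinearMap Subtype.val_injective
  -- `ψ^* φ^* = (ψ ≫ φ)^* = (φ ∘ ψ)^* ∈ S_λ ⊗ ℂ`
  have hT : pullbackOne A ψ * pullbackOne A φ ∈ symmetricPullbackSpan A h := by
    refine ⟨?_, fun x y ↦ ?_⟩
    · rw [← pullbackOne_comp']
      exact Submodule.subset_span ⟨ψ ≫ φ, rfl⟩
    · have hφψ : ∀ z, pullbackOne A φ (pullbackOne A ψ z) = -(pullbackOne A ψ (pullbackOne A φ z)) := fun z ↦ by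
        have e := congrArg (fun T : Module.End ℂ (complexBetti A.X 1) ↦ T z) hanti
        simp only [Module.End.mul_apply, LinearMap.neg_apply] at e
        rw [← neg_eq_iff_eq_neg] at e
        exact e.symm
      rw [Module.End.mul_apply, Module.End.mul_apply, hψsym, hskew, hφψ, map_neg, neg_neg]
  obtain ⟨v, hv⟩ := hψu
  have hvS : (v : Module.End ℂ (complexBetti A.X 1)) ∈ S :=
    hv ▸ Algebra.subset_adjoin (pullbackOne_mem_symmetricPullbackSpan hψsym)
  have hvinv : (↑v⁻¹ : Module.End ℂ (complexBetti A.X 1)) ∈ S := val_inv_mem_of_mem' S v hvS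
  have hφeq : pullbackOne A φ = ↑v⁻¹ * (pullbackOne A ψ * pullbackOne A φ) := by
    rw [← mul_assoc, ← hv, Units.inv_mul, one_mul]
  rw [hφeq]
  exact S.mul_mem hvinv (Algebra.subset_adjoin hT)

/-! ### §2 Determinant `1` on the eigenspaces of a skew `φ^*` -/

/-- `ψ^*` maps `ker(φ^* - τ)` into `ker(φ^* + τ)` when `ψ^* φ^* = -φ^* ψ^*`. [folklore] -/
private theorem apply_mem_eigenspace_neg_of_anticomm
    (hanti : pullbackOne A ψ * pullbackOne A φ = -(pullbackOne A φ * pullbackOne A ψ)) {τ : ℂ}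
    {x : complexBetti A.X 1} (hx : x ∈ Module.End.eigenspace (pullbackOne A φ) τ) :
    pullbackOne A ψ x ∈ Module.End.eigenspace (pullbackOne A φ) (-τ) := by
  rw [Module.End.mem_eigenspace_iff] at hx ⊢
  have e := congrArg (fun T : Module.End ℂ (complexBetti A.X 1) ↦ T x) hanti
  simp only [Module.End.mul_apply, LinearMap.neg_apply, hx, map_smul] at e
  rw [← neg_eq_iff_eq_neg] at e
  rw [← e, neg_smul]

/-- The inverse `(ψ^*)⁻¹` maps `ker(φ^* + τ)` into `ker(φ^* - τ)` when `ψ^* φ^* = -φ^* ψ^*`. [folklore] -/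
private theorem inv_apply_mem_eigenspace_of_anticomm (v : (Module.End ℂ (complexBetti A.X 1))ˣ)
    (hv : (v : Module.End ℂ (complexBetti A.X 1)) = pullbackOne A ψ)
    (hanti : pullbackOne A ψ * pullbackOne A φ = -(pullbackOne A φ * pullbackOne A ψ)) {τ : ℂ}
    {z : complexBetti A.X 1} (hz : z ∈ Module.End.eigenspace (pullbackOne A φ) (-τ)) :
    (↑v⁻¹ : Module.End ℂ (complexBetti A.X 1)) z ∈ Module.End.eigenspace (pullbackOne A φ) τ := by
  rw [Module.End.mem_eigenspace_iff] at hz ⊢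
  -- `φ ψ⁻¹ = -ψ⁻¹ φ`, from `ψ φ = -φ ψ`
  have hanti' : pullbackOne A φ * (↑v⁻¹ : Module.End ℂ (complexBetti A.X 1)) =
      -((↑v⁻¹ : Module.End ℂ (complexBetti A.X 1)) * pullbackOne A φ) := by
    have e : (↑v⁻¹ : Module.End ℂ (complexBetti A.X 1)) * (pullbackOne A ψ * pullbackOne A φ) * ↑v⁻¹ =
        (↑v⁻¹ : Module.End ℂ (complexBetti A.X 1)) * (-(pullbackOne A φ * pullbackOne A ψ)) * ↑v⁻¹ := by rw [hanti]
    rw [← hv, ← mul_assoc, Units.inv_mul, one_mul, mul_neg, neg_mul, mul_assoc, mul_assoc, Units.mul_inv,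
      mul_one] at e
    exact e
  have e := congrArg (fun T : Module.End ℂ (complexBetti A.X 1) ↦ T z) hanti'
  simp only [Module.End.mul_apply, LinearMap.neg_apply, hz, map_smul] at e
  rw [e, neg_smul, neg_neg]

/-- **Every `u ∈ G_div(X)(ℂ)` has determinant `1` on each eigenspace `V^{(τ)} = ker(φ^* - τ)` of a `†`-SKEW pull-back
`φ^*` admitting a `†`-symmetric invertible `ψ^*` with `ψ^* φ^* = -φ^* ψ^*`** (`P(φ) = 0`, `P` irreducible, `Q_h`
non-degenerate, `0 < dim A`). Road (the carrier form of the type-2 factor «`G_div^{(σ)} = Sp`»): `u` commutes with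
`φ^* ∈ B ⊗ ℂ` (§1) and with `ψ^* ∈ S_λ ⊗ ℂ`; the eigenspaces of the skew `φ^*` pair off, `Q_h(V^{(τ)}, V^{(τ′)}) = 0` unless
`τ′ = -τ`, and `ψ^*` exchanges `V^{(τ)}` and `V^{(-τ)}`; so `B(x, y) = Q_h(x, ψ^* y)` is a NON-DEGENERATE ALTERNATING form
on `V^{(τ)}` (`Q_h(x, ψ^* x) = Q_h(ψ^* x, x) = -Q_h(x, ψ^* x)`), preserved by `u|V^{(τ)}`, whence `det(u | V^{(τ)}) = 1`
(`LinearAlgebra.det_eq_one_of_isAlt_of_forall_apply_apply_eq`).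
[cite: MoonenZarhin1998WeilClasses, §1 (chunk p0002 L86–L92) and proof of Criterion (2) (chunk p0003 L62–L70)]
[cite: McDuffSalamon2017, Lemma 1.1.15] -/
theorem detOnEigenspace_eq_one_of_mem_divisorLefschetzGroup_of_skew (hA : 0 < A.dim)
    (hPirr : Irreducible (P.map (Int.castRingHom ℚ)))
    (hφ : Polynomial.eval₂ (Int.castRingHom (CategoryTheory.End A)) (φ : CategoryTheory.End A) P = 0)
    (hnd : ∀ x : complexBetti A.X 1, (∀ y, polarizationPairingOne A.X h (A.dim - 1) x y = 0) → x = 0)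
    (hskew : ∀ x y : complexBetti A.X 1, polarizationPairingOne A.X h (A.dim - 1) (pullbackOne A φ x) y =
      -polarizationPairingOne A.X h (A.dim - 1) x (pullbackOne A φ y))
    (hψsym : ∀ x y : complexBetti A.X 1, polarizationPairingOne A.X h (A.dim - 1) (pullbackOne A ψ x) y =
      polarizationPairingOne A.X h (A.dim - 1) x (pullbackOne A ψ y))
    (hψu : IsUnit (pullbackOne A ψ))
    (hanti : pullbackOne A ψ * pullbackOne A φ = -(pullbackOne A φ * pullbackOne A ψ))
    (hu : u ∈ divisorLefschetzGroup A h) (τ : ℂ) :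
    detOnEigenspace u (pullbackOne A φ)
      (fun x ↦ divisorLefschetzGroup_comm_of_mem_adjoin hu
        (pullbackOne_mem_adjoin_symmetricPullbackSpan_of_skew hskew hψsym hψu hanti) x) τ = 1 := by
  classical
  haveI hfin : Module.Finite ℂ (complexBetti A.X 1) := abelianVarietyCohomologyExteriorH1_holds.finite_one A
  have hφB := pullbackOne_mem_adjoin_symmetricPullbackSpan_of_skew hskew hψsym hψu hanti
  have hcomm : ∀ x, u (pullbackOne A φ x) = pullbackOne A φ (u x) := fun x ↦
    divisorLefschetzGroup_comm_of_mem_adjoin hu hφB x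
  have hcommψ : ∀ x, u (pullbackOne A ψ x) = pullbackOne A ψ (u x) := fun x ↦
    hu.1 _ (pullbackOne_mem_symmetricPullbackSpan hψsym) x
  obtain ⟨v, hv⟩ := hψu
  set Q := polarizationPairingOne A.X h (A.dim - 1) with hQdef
  set Vτ := Module.End.eigenspace (pullbackOne A φ) τ with hVτ
  -- a coordinate `ℓ` of the top line `H^{2 dim A}(A(ℂ); ℂ) ≅ ℂ` (`0 < dim A`; Hatcher Cor. 3.37)
  have hA1 : A.dim = (A.dim - 1) + 1 := by omega
  have htop := Motives.finrank_complexBetti_two_add_two_mul_eq_one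
    (hA1 ▸ AbelianVariety.isSmoothProjective_holds (A := A) : IsSmoothProjective ((A.dim - 1) + 1) A.X)
  haveI : FiniteDimensional ℂ (complexBetti A.X (2 + 2 * (A.dim - 1))) := Module.finite_of_finrank_eq_succ htop
  obtain ⟨ℓ, hℓ⟩ : ∃ ℓ : complexBetti A.X (2 + 2 * (A.dim - 1)) →ₗ[ℂ] ℂ, Function.Injective ℓ :=
    ⟨_, (LinearEquiv.ofFinrankEq _ _ (htop.trans (Module.finrank_self ℂ).symm)).injective⟩
  -- skew-orthogonality of the eigenspaces: `Q_h(V^{(τ)}, V^{(τ')}) = 0` unless `τ = -τ'`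
  have horth : ∀ {τ₁ τ₂ : ℂ}, τ₁ ≠ -τ₂ → ∀ {x y : complexBetti A.X 1},
      x ∈ Module.End.eigenspace (pullbackOne A φ) τ₁ → y ∈ Module.End.eigenspace (pullbackOne A φ) τ₂ → Q x y = 0 := by
    intro τ₁ τ₂ hne x y hx hy
    refine polarizationPairingOne_eq_zero_of_mem_eigenspace_of_ne_eval (q := -X) (fun x y ↦ ?_) (by simpa using hne) hx hy
    rw [map_neg, aeval_X, LinearMap.neg_apply, map_neg]
    exact hskew x y
  -- the alternating form `B(x, y) = ℓ(Q_h(x, ψ^* y))` on `V^{(τ)}`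
  set B : LinearMap.BilinForm ℂ Vτ := ((Q.compl₂ (pullbackOne A ψ)).compl₁₂ Vτ.subtype Vτ.subtype).compr₂ ℓ with hBdef
  have hBapply : ∀ x y : Vτ, B x y = ℓ (Q (x : complexBetti A.X 1) (pullbackOne A ψ (y : complexBetti A.X 1))) :=
    fun x y ↦ rfl
  have hBalt : B.IsAlt := fun x ↦ by
    rw [hBapply]
    have e : Q (x : complexBetti A.X 1) (pullbackOne A ψ (x : complexBetti A.X 1)) = 0 := by
      have e1 := hψsym (x : complexBetti A.X 1) (x : complexBetti A.X 1)
      have e2 := polarizationPairingOne_swap h (A.dim - 1) (x : complexBetti A.X 1) (pullbackOne A ψ (x : complexBetti A.X 1))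
      rw [← hQdef] at e2
      -- `Q(ψx, x) = -Q(x, ψx)` and `Q(ψx, x) = Q(x, ψx)`
      have e3 : Q (x : complexBetti A.X 1) (pullbackOne A ψ (x : complexBetti A.X 1)) =
          -Q (x : complexBetti A.X 1) (pullbackOne A ψ (x : complexBetti A.X 1)) := e1.symm.trans e2
      rw [eq_neg_iff_add_eq_zero, ← two_smul ℂ] at e3
      exact (smul_eq_zero.1 e3).resolve_left two_ne_zero
    rw [e, map_zero]
  have hBsep : B.SeparatingLeft := by
    intro x hx
    have hx0 : ∀ y : complexBetti A.X 1, Q (x : complexBetti A.X 1) y = 0 := by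
      intro y
      have hy := mem_iSup_eigenspace_pullbackOne hPirr hφ y
      induction hy using Submodule.iSup_induction' with
      | mem τ' z hz =>
        by_cases hττ' : τ = -τ'
        · -- `z ∈ V^{(-τ)}`: `z = ψ (ψ⁻¹ z)` with `ψ⁻¹ z ∈ V^{(τ)}`
          have hτ' : τ' = -τ := by rw [hττ', neg_neg]
          subst hτ'
          have hz' : (↑v⁻¹ : Module.End ℂ (complexBetti A.X 1)) z ∈ Vτ :=
            inv_apply_mem_eigenspace_of_anticomm v hv hanti hz
          have e := hx ⟨_, hz'⟩
          rw [hBapply] at e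
          have e' : Q (x : complexBetti A.X 1) (pullbackOne A ψ ((↑v⁻¹ : Module.End ℂ (complexBetti A.X 1)) z)) = 0 :=
            hℓ (by rw [e, map_zero])
          rwa [← hv, ← Module.End.mul_apply, Units.mul_inv, Module.End.one_apply] at e'
        · exact horth hττ' x.2 hz
      | zero => rw [map_zero]
      | add z w _ _ hz hw => rw [map_add, hz, hw, add_zero]
    exact Subtype.ext (hnd _ hx0)
  have hBnd : B.Nondegenerate := (LinearMap.IsRefl.nondegenerate_iff_separatingLeft (LinearMap.IsAlt.isRefl hBalt)).2 hBsep
  -- `u|V^{(τ)}` is an isometry of `B`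
  have hiso : ∀ x y : Vτ,
      B (((u : complexBetti A.X 1 →ₗ[ℂ] complexBetti A.X 1).restrict (VanGeemen1994.mapsTo_eigenspace_of_comm hcomm τ)) x)
        (((u : complexBetti A.X 1 →ₗ[ℂ] complexBetti A.X 1).restrict (VanGeemen1994.mapsTo_eigenspace_of_comm hcomm τ)) y) =
      B x y := fun x y ↦ by
    rw [hBapply, hBapply, LinearMap.coe_restrict_apply, LinearMap.coe_restrict_apply, LinearEquiv.coe_coe, ← hcommψ,
      hQdef, hu.2]
  exact Literature.LinearAlgebra.det_eq_one_of_isAlt_of_forall_apply_apply_eq B hBalt hBnd _ hiso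

/-- The same for Milne's smaller group `S(A)(h)(ℂ) ≤ G_div(X)(h)(ℂ)` (`unitaryCentralizerGroup_le_divisorLefschetzGroup`).
[cite: MoonenZarhin1998WeilClasses, §1 (chunk p0002 L86–L92)] [cite: Milne1999LefschetzClasses, §1 p. 644] -/
theorem detOnEigenspace_eq_one_of_mem_unitaryCentralizerGroup_of_skew (hA : 0 < A.dim)
    (hPirr : Irreducible (P.map (Int.castRingHom ℚ)))
    (hφ : Polynomial.eval₂ (Int.castRingHom (CategoryTheory.End A)) (φ : CategoryTheory.End A) P = 0)
    (hnd : ∀ x : complexBetti A.X 1, (∀ y, polarizationPairingOne A.X h (A.dim - 1) x y = 0) → x = 0)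
    (hskew : ∀ x y : complexBetti A.X 1, polarizationPairingOne A.X h (A.dim - 1) (pullbackOne A φ x) y =
      -polarizationPairingOne A.X h (A.dim - 1) x (pullbackOne A φ y))
    (hψsym : ∀ x y : complexBetti A.X 1, polarizationPairingOne A.X h (A.dim - 1) (pullbackOne A ψ x) y =
      polarizationPairingOne A.X h (A.dim - 1) x (pullbackOne A ψ y))
    (hψu : IsUnit (pullbackOne A ψ))
    (hanti : pullbackOne A ψ * pullbackOne A φ = -(pullbackOne A φ * pullbackOne A ψ))
    (hu : u ∈ unitaryCentralizerGroup A h) (τ : ℂ) :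
    detOnEigenspace u (pullbackOne A φ)
      (fun x ↦ divisorLefschetzGroup_comm_of_mem_adjoin (unitaryCentralizerGroup_le_divisorLefschetzGroup hu)
        (pullbackOne_mem_adjoin_symmetricPullbackSpan_of_skew hskew hψsym hψu hanti) x) τ = 1 :=
  detOnEigenspace_eq_one_of_mem_divisorLefschetzGroup_of_skew hA hPirr hφ hnd hskew hψsym hψu hanti
    (unitaryCentralizerGroup_le_divisorLefschetzGroup hu) τ

/-! ### §3 Decomposability — and algebraicity, by the Lefschetz theorem on `(1,1)`-classes -/

/-- **Weil classes relative to `F = ℚ(φ)`, `φ` Rosati-SKEW with a Rosati-symmetric anticommuting unit `ψ`, are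
decomposable** — Moonen–Zarhin's Criterion (2) in the configuration `F = E(α)`, `α† = -α`, `β† = β`, `αβ = -βα` of
«`Y` of Type 2» (indefinite quaternion algebra `D = End⁰(Y)`; there the print has ALL `W_F` decomposable), proved on the
carrier WITHOUT «`G_div(X)` is connected and semi-simple»: for `P(φ) = 0` (`P ∈ ℤ[T]` monic irreducible of degree `e`, `e · 2m = 2 dim A`), `h ∈ B¹(A) ⊗ ℂ` with `Q_h`
non-degenerate, `Q_h(φ^* x, y) = -Q_h(x, φ^* y)`, and an endomorphism `ψ` with `ψ^*` `Q_h`-symmetric, invertible,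
`ψ^* φ^* = -φ^* ψ^*`: `W_F ⊗ ℂ ≤ 𝒟ᵐ ⊗ ℂ` (`φ^* ∈ B ⊗ ℂ` by §1; `det(u | V^{(ρ)}) = 1` by §2; the seat's g14-#3
`weilClassesField_le_divisorClassesSpan_iff_forall_detOnEigenspace_eq_one_of_mem_adjoin`). Consistency with the print:
in type 3 with `m = 1` (definite quaternions, `†` = canonical involution) and in type 4 with `d = m = 1` (CM field) no
symmetric `ψ` anticommutes with a skew `φ ∉ E` resp. `∉ E₀` — and there `W_F` is exceptional.
[cite: MoonenZarhin1998WeilClasses, §1 Criterion (2) and its proof (chunk p0003 L46–L70)] [cite: McDuffSalamon2017, Lemma 1.1.15] -/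
theorem weilClassesField_le_divisorClassesSpan_of_skew (hA : 0 < A.dim)
    (hPm : P.Monic) (hPe : P.natDegree = e) (hPirr : Irreducible (P.map (Int.castRingHom ℚ)))
    (hφ : Polynomial.eval₂ (Int.castRingHom (CategoryTheory.End A)) (φ : CategoryTheory.End A) P = 0)
    (her : e * (2 * m) = 2 * A.dim) (hh : h ∈ hodgeClassSpan A.dim A.X 1)
    (hnd : ∀ x : complexBetti A.X 1, (∀ y, polarizationPairingOne A.X h (A.dim - 1) x y = 0) → x = 0)
    (hskew : ∀ x y : complexBetti A.X 1, polarizationPairingOne A.X h (A.dim - 1) (pullbackOne A φ x) y =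
      -polarizationPairingOne A.X h (A.dim - 1) x (pullbackOne A φ y))
    (hψsym : ∀ x y : complexBetti A.X 1, polarizationPairingOne A.X h (A.dim - 1) (pullbackOne A ψ x) y =
      polarizationPairingOne A.X h (A.dim - 1) x (pullbackOne A ψ y))
    (hψu : IsUnit (pullbackOne A ψ))
    (hanti : pullbackOne A ψ * pullbackOne A φ = -(pullbackOne A φ * pullbackOne A ψ)) :
    weilClassesField A φ P (2 * m) ≤ divisorClassesSpan A.X A.dim m :=
  (weilClassesField_le_divisorClassesSpan_iff_forall_detOnEigenspace_eq_one_of_mem_adjoin hPm hPe hPirr hφ her hh hnd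
      (pullbackOne_mem_adjoin_symmetricPullbackSpan_of_skew hskew hψsym hψu hanti)).2
    fun _ hu ρ _ ↦ detOnEigenspace_eq_one_of_mem_divisorLefschetzGroup_of_skew hA hPirr hφ hnd hskew hψsym hψu hanti hu ρ

/-- **… and are HODGE classes**: `W_F ⊗ ℂ ≤ 𝒟ᵐ ⊗ ℂ ≤ ℬᵐ ⊗ ℂ` (the previous theorem, then `𝒟ᵐ ⊆ ℬᵐ`, the tree's
`divisorClassesSpan_le_hodgeClassSpan_of_isSmoothProjective`). [cite: MoonenZarhin1998WeilClasses, §1 Criterion (2) (chunk p0003 L46–L58)]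
[cite: vanGeemen1994HodgeAV, §2.4] -/
theorem weilClassesField_le_hodgeClassSpan_of_skew (hA : 0 < A.dim)
    (hPm : P.Monic) (hPe : P.natDegree = e) (hPirr : Irreducible (P.map (Int.castRingHom ℚ)))
    (hφ : Polynomial.eval₂ (Int.castRingHom (CategoryTheory.End A)) (φ : CategoryTheory.End A) P = 0)
    (her : e * (2 * m) = 2 * A.dim) (hh : h ∈ hodgeClassSpan A.dim A.X 1)
    (hnd : ∀ x : complexBetti A.X 1, (∀ y, polarizationPairingOne A.X h (A.dim - 1) x y = 0) → x = 0)
    (hskew : ∀ x y : complexBetti A.X 1, polarizationPairingOne A.X h (A.dim - 1) (pullbackOne A φ x) y =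
      -polarizationPairingOne A.X h (A.dim - 1) x (pullbackOne A φ y))
    (hψsym : ∀ x y : complexBetti A.X 1, polarizationPairingOne A.X h (A.dim - 1) (pullbackOne A ψ x) y =
      polarizationPairingOne A.X h (A.dim - 1) x (pullbackOne A ψ y))
    (hψu : IsUnit (pullbackOne A ψ))
    (hanti : pullbackOne A ψ * pullbackOne A φ = -(pullbackOne A φ * pullbackOne A ψ)) :
    weilClassesField A φ P (2 * m) ≤ hodgeClassSpan A.dim A.X m :=
  (weilClassesField_le_divisorClassesSpan_of_skew hA hPm hPe hPirr hφ her hh hnd hskew hψsym hψu hanti).trans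
    (divisorClassesSpan_le_hodgeClassSpan_of_isSmoothProjective (AbelianVariety.isSmoothProjective_holds (A := A)) m)

/-- **… and are ALGEBRAIC**: `W_F ⊗ ℂ ≤ N^m H^{2m}(A(ℂ); ℂ)` (`algebraicClasses A.X m`) — «as a consequence of the
Lefschetz theorem on `(1,1)` classes, the decomposable classes are algebraic» (the tree's theorem
`lefschetzOneOne_rational_holds` through `AbelianVariety.divisorClassesSpan_le_algebraicClasses`): THE WEIL CLASSES
RELATIVE TO `F = ℚ(φ)` IN THE TYPE-2 CONFIGURATION (`φ† = -φ`, `ψ† = ψ` invertible, `ψφ = -φψ`) ARE ALGEBRAIC.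
[cite: MoonenZarhin1998WeilClasses, Introduction (chunk p0001 L10–L18) and §1 Criterion (2) (chunk p0003 L46–L70)]
[cite: VoisinHodgeI2002, Thm. 11.30] -/
theorem weilClassesField_le_algebraicClasses_of_skew (hA : 0 < A.dim)
    (hPm : P.Monic) (hPe : P.natDegree = e) (hPirr : Irreducible (P.map (Int.castRingHom ℚ)))
    (hφ : Polynomial.eval₂ (Int.castRingHom (CategoryTheory.End A)) (φ : CategoryTheory.End A) P = 0)
    (her : e * (2 * m) = 2 * A.dim) (hh : h ∈ hodgeClassSpan A.dim A.X 1)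
    (hnd : ∀ x : complexBetti A.X 1, (∀ y, polarizationPairingOne A.X h (A.dim - 1) x y = 0) → x = 0)
    (hskew : ∀ x y : complexBetti A.X 1, polarizationPairingOne A.X h (A.dim - 1) (pullbackOne A φ x) y =
      -polarizationPairingOne A.X h (A.dim - 1) x (pullbackOne A φ y))
    (hψsym : ∀ x y : complexBetti A.X 1, polarizationPairingOne A.X h (A.dim - 1) (pullbackOne A ψ x) y =
      polarizationPairingOne A.X h (A.dim - 1) x (pullbackOne A ψ y))
    (hψu : IsUnit (pullbackOne A ψ))
    (hanti : pullbackOne A ψ * pullbackOne A φ = -(pullbackOne A φ * pullbackOne A ψ)) :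
    weilClassesField A φ P (2 * m) ≤ algebraicClasses A.X m :=
  (weilClassesField_le_divisorClassesSpan_of_skew hA hPm hPe hPirr hφ her hh hnd hskew hψsym hψu hanti).trans
    (AbelianVariety.divisorClassesSpan_le_algebraicClasses A
      (fun b hb hb' ↦ lefschetzOneOne_rational_holds (AbelianVariety.isSmoothProjective_holds (A := A)) b hb hb') m)

/-- Element form: every class of `W_F ⊗ ℂ` (in particular every rational Weil class relative to `F`) lies in the
`ℂ`-span of the algebraic classes. [cite: MoonenZarhin1998WeilClasses, Introduction (chunk p0001 L10–L18)] -/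
theorem mem_algebraicClasses_of_mem_weilClassesField_of_skew (hA : 0 < A.dim)
    (hPm : P.Monic) (hPe : P.natDegree = e) (hPirr : Irreducible (P.map (Int.castRingHom ℚ)))
    (hφ : Polynomial.eval₂ (Int.castRingHom (CategoryTheory.End A)) (φ : CategoryTheory.End A) P = 0)
    (her : e * (2 * m) = 2 * A.dim) (hh : h ∈ hodgeClassSpan A.dim A.X 1)
    (hnd : ∀ x : complexBetti A.X 1, (∀ y, polarizationPairingOne A.X h (A.dim - 1) x y = 0) → x = 0)
    (hskew : ∀ x y : complexBetti A.X 1, polarizationPairingOne A.X h (A.dim - 1) (pullbackOne A φ x) y =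
      -polarizationPairingOne A.X h (A.dim - 1) x (pullbackOne A φ y))
    (hψsym : ∀ x y : complexBetti A.X 1, polarizationPairingOne A.X h (A.dim - 1) (pullbackOne A ψ x) y =
      polarizationPairingOne A.X h (A.dim - 1) x (pullbackOne A ψ y))
    (hψu : IsUnit (pullbackOne A ψ))
    (hanti : pullbackOne A ψ * pullbackOne A φ = -(pullbackOne A φ * pullbackOne A ψ))
    {c : complexBetti A.X (2 * m)} (hc : c ∈ weilClassesField A φ P (2 * m)) : c ∈ algebraicClasses A.X m :=
  weilClassesField_le_algebraicClasses_of_skew hA hPm hPe hPirr hφ her hh hnd hskew hψsym hψu hanti hc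

end HodgeTheory

end Literature.AlgebraicGeometry.HodgeTheory

end
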